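import Summits.Ventures.PercRepro.C026PFunDefs

/-!
# The (P) functional of a star skeleton: the closed form of mine-3 §27 (i) (p6, gen 16)

The `k`-star skeleton `star ι` has the probe `none`, the pendant vertices `some i` (`i : ι`) and
the edge `i` joining `none` to `some i`.  In a configuration `ω` the open cluster of the probe is
`{none} ∪ {some i | ω i = true}` and every other vertex is isolated (`star_clusters`), so the
(P) functional collapses to a sum over the subsets `S ⊆ ι` of products over `S` and `Sᶜ`, and
`∑_S ∏_{i ∈ S} f i ∏_{i ∉ S} g i = ∏_i (f i + g i)` gives **THEOREM S (i)**, the exact closed form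

`(P_star) = ∏_i (3 − x_i) − 2^{k+1}·Z_A + 2·K_A·∏_i (1 + n̄_i K_i) − K_A·Z_A·∏_i (n̄_i K_i + x_i)`

(`n̄_i = 2 − x_i`; `Z_A = x none`, `K_A = K none`), `pFun_star_eq`.
-/

namespace PercRepro

namespace MultiGraph

open Finset

/-- The `k`-star skeleton on `Option ι`: the edge `i` joins the probe `none` to `some i`. -/
def star (ι : Type*) : MultiGraph (Option ι) ι := ⟨fun _ => none, fun i => some i⟩

variable {ι : Type*}

/-- `StarHub ω u`: `u` is the probe or a pendant vertex whose edge is open in `ω`. -/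
def StarHub (ω : Config ι) (u : Option ι) : Prop := u = none ∨ ∃ i, u = some i ∧ ω i = true

/-- The probe is in the hub. -/
theorem starHub_none (ω : Config ι) : StarHub ω none := Or.inl rfl

/-- A pendant vertex with an open edge is in the hub. -/
theorem starHub_some {ω : Config ι} {i : ι} (hi : ω i = true) : StarHub ω (some i) :=
  Or.inr ⟨i, rfl, hi⟩

/-- A pendant vertex with a closed edge is not in the hub. -/
theorem not_starHub_some {ω : Config ι} {i : ι} (hi : ω i = false) : ¬ StarHub ω (some i) := by
  rintro (h | ⟨j, hj, hω⟩)
  · exact Option.some_ne_none i h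
  · rw [Option.some_inj] at hj
    subst hj
    rw [hi] at hω
    exact Bool.false_ne_true hω

/-- Both ends of an open edge of the star are in the hub. -/
theorem starHub_of_openAdj {ω : Config ι} {a b : Option ι} (h : (star ι).OpenAdj ω a b) :
    StarHub ω a ∧ StarHub ω b := by
  obtain ⟨i, hi, h | h⟩ := h
  · obtain ⟨rfl, rfl⟩ := h
    exact ⟨starHub_none ω, starHub_some hi⟩
  · obtain ⟨rfl, rfl⟩ := h
    exact ⟨starHub_some hi, starHub_none ω⟩

/-- A hub vertex is connected to the probe. -/
theorem star_conn_none_of_starHub {ω : Config ι} {u : Option ι} (h : StarHub ω u) :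
    (star ι).Conn ω u none := by
  rcases h with rfl | ⟨i, rfl, hi⟩
  · exact Conn.refl _ ω none
  · exact Conn.of_openAdj ⟨i, hi, Or.inr ⟨rfl, rfl⟩⟩

/-- **Connectivity in the star**: `u ↔ v` iff `u = v` or both lie in the hub. -/
theorem star_conn_iff {ω : Config ι} {u v : Option ι} :
    (star ι).Conn ω u v ↔ u = v ∨ (StarHub ω u ∧ StarHub ω v) := by
  constructor
  · intro h
    refine Conn.induction (motive := fun w => u = w ∨ (StarHub ω u ∧ StarHub ω w))
      (Or.inl rfl) ?_ h
    intro a b _ hab ih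
    have hb := (starHub_of_openAdj hab)
    rcases ih with rfl | ⟨hu, _⟩
    · exact Or.inr ⟨hb.1, hb.2⟩
    · exact Or.inr ⟨hu, hb.2⟩
  · rintro (rfl | ⟨hu, hv⟩)
    · exact Conn.refl _ ω u
    · exact (star_conn_none_of_starHub hu).trans (star_conn_none_of_starHub hv).symm

section Clusters

variable [Fintype ι] [DecidableEq ι]

/-- The embedding `some : ι ↪ Option ι`. -/
def someEmb (ι : Type*) : ι ↪ Option ι := ⟨some, Option.some_injective ι⟩

/-- The cluster of the probe: the probe and the pendant vertices with open edges. -/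
theorem star_clusterF_none (ω : Config ι) :
    (star ι).clusterF ω none = insert none ((openEdges ω).map (someEmb ι)) := by
  ext u
  rw [mem_clusterF, star_conn_iff, Finset.mem_insert, Finset.mem_map]
  constructor
  · rintro (h | ⟨_, hu⟩)
    · exact Or.inl h.symm
    · rcases hu with rfl | ⟨i, rfl, hi⟩
      · exact Or.inl rfl
      · exact Or.inr ⟨i, mem_openEdges.2 hi, rfl⟩
  · rintro (rfl | ⟨i, hi, rfl⟩)
    · exact Or.inl rfl
    · exact Or.inr ⟨starHub_none ω, starHub_some (mem_openEdges.1 hi)⟩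

omit [DecidableEq ι] in
/-- A pendant vertex with a closed edge is isolated. -/
theorem star_clusterF_some_of_closed {ω : Config ι} {i : ι} (hi : ω i = false) :
    (star ι).clusterF ω (some i) = {some i} := by
  ext u
  rw [mem_clusterF, star_conn_iff, Finset.mem_singleton]
  constructor
  · rintro (h | ⟨h, _⟩)
    · exact h.symm
    · exact absurd h (not_starHub_some hi)
  · rintro rfl
    exact Or.inl rfl

omit [DecidableEq ι] in
/-- A pendant vertex with an open edge has the probe's cluster. -/
theorem star_clusterF_some_of_open {ω : Config ι} {i : ι} (hi : ω i = true) :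
    (star ι).clusterF ω (some i) = (star ι).clusterF ω none :=
  clusterF_eq_of_conn (star_conn_none_of_starHub (starHub_some hi))

omit [DecidableEq ι] in
/-- The probe's cluster is not a pendant singleton. -/
theorem star_clusterF_none_ne_singleton (ω : Config ι) (i : ι) :
    (star ι).clusterF ω none ≠ {some i} := by
  intro h
  have := self_mem_clusterF (G := star ι) ω none
  rw [h, Finset.mem_singleton] at this
  exact Option.some_ne_none i this.symm

/-- **The clusters of the star**: the probe's cluster and the isolated pendant vertices. -/
theorem star_clusters (ω : Config ι) :
    (star ι).clusters ω =
      insert ((star ι).clusterF ω none) ((openEdges ω)ᶜ.image fun i => ({some i} : Finset (Option ι))) := by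
  ext R
  rw [mem_clusters, Finset.mem_insert, Finset.mem_image]
  constructor
  · rintro ⟨u, rfl⟩
    rcases u with _ | i
    · exact Or.inl rfl
    · cases hi : ω i
      · refine Or.inr ⟨i, ?_, (star_clusterF_some_of_closed hi).symm⟩
        rw [Finset.mem_compl, mem_openEdges, hi]
        exact Bool.false_ne_true
      · exact Or.inl (star_clusterF_some_of_open hi)
  · rintro (rfl | ⟨i, hi, rfl⟩)
    · exact ⟨none, rfl⟩
    · refine ⟨some i, star_clusterF_some_of_closed ?_⟩
      rw [Finset.mem_compl, mem_openEdges] at hi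
      cases h : ω i
      · rfl
      · exact absurd h hi

/-- The probe's cluster is not among the pendant singletons. -/
theorem star_clusterF_none_notMem_image (ω : Config ι) :
    (star ι).clusterF ω none ∉ (openEdges ω)ᶜ.image fun i => ({some i} : Finset (Option ι)) := by
  rw [Finset.mem_image]
  rintro ⟨i, _, h⟩
  exact star_clusterF_none_ne_singleton ω i h.symm

omit [Fintype ι] [DecidableEq ι] in
/-- `none` is not in the image of `some`. -/
theorem none_notMem_map_someEmb (S : Finset ι) : (none : Option ι) ∉ S.map (someEmb ι) := by
  rw [Finset.mem_map]
  rintro ⟨i, _, h⟩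
  exact Option.some_ne_none i h

/-- `X_c` on the star: `Z_A` times the product over the open pendant vertices. -/
theorem star_xCluster (x : Option ι → ℝ) (ω : Config ι) :
    (star ι).xCluster x none ω = x none * ∏ i ∈ openEdges ω, x (some i) := by
  unfold xCluster
  rw [star_clusterF_none, Finset.prod_insert (none_notMem_map_someEmb _), Finset.prod_map]
  rfl

/-- `K_c` on the star: `K_A` times the product over the open pendant vertices. -/
theorem star_kCluster (K : Option ι → ℝ) (ω : Config ι) :
    (star ι).kCluster K none ω = K none * ∏ i ∈ openEdges ω, K (some i) := by
  unfold kCluster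
  rw [star_clusterF_none, Finset.prod_insert (none_notMem_map_someEmb _), Finset.prod_map]
  rfl

/-- `N_c` on the star: the product of `2 − x_i` over the closed pendant vertices. -/
theorem star_nbarOff (x : Option ι → ℝ) (ω : Config ι) :
    (star ι).nbarOff x none ω = ∏ i ∈ (openEdges ω)ᶜ, (2 - x (some i)) := by
  unfold nbarOff
  rw [star_clusters, Finset.erase_insert (star_clusterF_none_notMem_image ω), Finset.prod_image]
  · simp only [Finset.prod_singleton]
  · intro i _ j _ h
    exact Option.some_inj.1 (Finset.singleton_inj.1 h)

/-- `n̄` on the star. -/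
theorem star_nbar (x : Option ι → ℝ) (ω : Config ι) :
    (star ι).nbar x ω =
      (2 - x none * ∏ i ∈ openEdges ω, x (some i)) * ∏ i ∈ (openEdges ω)ᶜ, (2 - x (some i)) := by
  rw [nbar_eq_mul_nbarOff _ x none, star_xCluster, star_nbarOff]

/-- The complement of a configuration inside the full edge set. -/
theorem complIn_univ (ω : Config ι) : complIn (univ : Finset ι) ω = fun i => !ω i := by
  funext i
  simp [complIn]

/-- The open edges of the complementary configuration. -/
theorem openEdges_not (ω : Config ι) : openEdges (fun i => !ω i) = (openEdges ω)ᶜ := by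
  ext i
  simp [mem_openEdges]

/-- Every configuration lies inside the full edge set. -/
theorem configsIn_univ : configsIn (univ : Finset ι) = univ :=
  Finset.eq_univ_iff_forall.2 fun _ => mem_configsIn.2 fun e _ => Finset.mem_univ e

end Clusters

/-! ### The closed form -/

section ClosedForm

variable [Fintype ι] [DecidableEq ι]

/-- A sum over configurations is a sum over the sets of open edges. -/
theorem sum_config_eq_sum_finset (f : Finset ι → ℝ) :
    ∑ ω : Config ι, f (openEdges ω) = ∑ S : Finset ι, f S := by
  refine Finset.sum_nbij' openEdges (fun S i => decide (i ∈ S)) (fun _ _ => Finset.mem_univ _)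
    (fun _ _ => Finset.mem_univ _) ?_ ?_ (fun _ _ => rfl)
  · intro ω _
    funext i
    simp [mem_openEdges]
  · intro S _
    ext i
    simp [mem_openEdges]

/-- The summand of the star's (P) functional at the set `S` of open edges, in the four-product form. -/
def starTerm (x K : Option ι → ℝ) (S : Finset ι) : ℝ :=
  (∏ _i ∈ S, (1 : ℝ)) * (∏ i ∈ Sᶜ, (2 - x (some i))) -
    2 * x none * ((∏ i ∈ S, x (some i)) * ∏ i ∈ Sᶜ, (2 - x (some i))) +
    2 * K none * ((∏ i ∈ S, (2 - x (some i)) * K (some i)) * ∏ _i ∈ Sᶜ, (1 : ℝ)) -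
    K none * x none * ((∏ i ∈ S, (2 - x (some i)) * K (some i)) * ∏ i ∈ Sᶜ, x (some i))

/-- The summand of the star's (P) functional is `starTerm` of the open edges. -/
theorem star_summand_eq (x K : Option ι → ℝ) (ω : Config ι) :
    (star ι).nbarOff x none ω * (1 - 2 * (star ι).xCluster x none ω) +
      (star ι).kCluster K none ω * (star ι).nbar x (complIn univ ω) =
    starTerm x K (openEdges ω) := by
  unfold starTerm
  rw [star_nbarOff, star_xCluster, star_kCluster, complIn_univ, star_nbar, openEdges_not,
    compl_compl, Finset.prod_mul_distrib, Finset.prod_const_one, Finset.prod_const_one]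
  ring

/-- **THEOREM S (i) (mine-3 §27)**: the (P) functional of the `k`-star in closed form. -/
theorem pFun_star_eq (x K : Option ι → ℝ) :
    (star ι).pFun none x K univ =
      (∏ i, (3 - x (some i))) - 2 ^ (Fintype.card ι + 1) * x none +
        2 * K none * ∏ i, (1 + (2 - x (some i)) * K (some i)) -
        K none * x none * ∏ i, ((2 - x (some i)) * K (some i) + x (some i)) := by
  unfold pFun
  rw [configsIn_univ, Finset.sum_congr rfl fun ω _ => star_summand_eq x K ω,
    sum_config_eq_sum_finset (starTerm x K)]
  have h1 : ∑ S : Finset ι, (∏ _i ∈ S, (1 : ℝ)) * ∏ i ∈ Sᶜ, (2 - x (some i)) =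
      ∏ i, (3 - x (some i)) := by
    rw [← Fintype.prod_add]
    exact Finset.prod_congr rfl fun i _ => by ring
  have h2 : ∑ S : Finset ι, (∏ i ∈ S, x (some i)) * ∏ i ∈ Sᶜ, (2 - x (some i)) =
      2 ^ Fintype.card ι := by
    rw [← Fintype.prod_add]
    simp
  have h3 : ∑ S : Finset ι, (∏ i ∈ S, (2 - x (some i)) * K (some i)) * ∏ _i ∈ Sᶜ, (1 : ℝ) =
      ∏ i, (1 + (2 - x (some i)) * K (some i)) := by
    rw [← Fintype.prod_add]
    exact Finset.prod_congr rfl fun i _ => by ring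
  have h4 : ∑ S : Finset ι, (∏ i ∈ S, (2 - x (some i)) * K (some i)) * ∏ i ∈ Sᶜ, x (some i) =
      ∏ i, ((2 - x (some i)) * K (some i) + x (some i)) := by
    rw [← Fintype.prod_add]
  unfold starTerm
  simp only [Finset.sum_add_distrib, Finset.sum_sub_distrib, ← Finset.mul_sum]
  rw [h1, h2, h3, h4]
  ring

end ClosedForm

end MultiGraph

end PercRepro
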